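import Mathlib
import Summits.NavierStokesRegularity.NavierStokesRegularity.Theorems.EulerZoomLiouvillePowerGaugeEulerLiouvilleSelfSimilarTopBadNodeArcTools
import HarnessLib.Audit

/-!
# Rung C1 of the crux `EulerZoomLiouville.PowerGaugeEulerLiouville`: TUBE DYNAMICS with forcing around the kernel graph
# (inventory item (vi-b) of the no-exit lemma — the transversal differential inequalities)

Route №10 `EulerZoomLiouville` (NavierStokesRegularity), crux E = stmt-NavierStokesRegularity-19832,
tenure rung C1 (exactly self-similar members), registered residue `stub_selfSimilarExtremal`.
Twenty-second file of the NODAL-CONTINUUM line (lineage ns-typeII-p1, gen 7).  Pure linear-algebra / ODE bookkeeping,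
abstracted from the profile: `A` a symmetric operator on `ℝ³` with `Ae = 0` (`|e| = 1`) and eigen-data `A bᵢ = aᵢ bᵢ`,
`aᵢ ≤ α`, `aᵢ > 0 ⇒ aᵢ ≥ μ`, and for `ξ ⊥ e`: `aᵢ ≤ 0 ⇒ (aᵢ ≤ −μ or ξᵢ = 0)` (the spectral data at a degenerate top bad node,
`exists_spectralData_of_badNode`); a curve `Y` with `Y' = −V(Y)`; a graph `σ ↦ z + σe + g(σ)` (`g ⊥ e`) over the kernel line;
tube coordinates `σ = ⟪e, Y − z⟫`, `ξ = Y − z − σe − g(σ) ⊥ e`; the TWO-POINT LINEARISATION hypothesis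
`|V(Y) − φ(σ)e − Aξ| ≤ ρ|ξ|` on `[0, t₁]` (`V = φe` on the graph) and `|g'(σ)| ≤ Λ ≤ 1` there.

* `norm_apply_ge_of_eigen` — `|Aξ| ≥ μ|ξ|` for such `ξ`.
* `tube_inequalities` — there are `p, m ≥ 0` (contracting / expanding parts of `|ξ|²` in the eigenframe), differentiable, with
  `p + m = |ξ|²`, `p' ≤ −μp + (18ρ²/μ)(p+m) + (2Λ²/μ)φ(σ)²`, `m' ≥ μm − (18ρ²/μ)(p+m) − (2Λ²/μ)φ(σ)²` on `[0, t₁]`,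
  `⟪Aξ, ξ⟫ ≤ αp − μm`, and `σ' = −φ(σ) − ⟪e, V(Y) − φ(σ)e − Aξ⟫`.
  (Mechanism: `ξ' = −Aξ − F`, `F = E − ⟪e,E⟫e − (φ + ⟪e,E⟫)g'(σ)`, `|F| ≤ 3ρ|ξ| + Λ|φ|`, AM–GM in each eigen-coordinate.)

WHAT THIS IS NOT: not NS, not E — no profile in this file; the assembly (sequel) instantiates `A = DV(z♭)`, `V` the
self-similar transport field, `Γ` the kernel graph of `exists_kernelGraph_of_corankOne`.
[cite: KatokHasselblatt1995, §6.2 (cone criterion)] [cite: ConstantinIgnatovaVicol2026Putative, §3.4.3–§3.5]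
-/

noncomputable section

-- flat `Theorems/<Route><Decl>…` files of one crux share the namespace of the crux (tree convention)
set_option linter.dupNamespace false

open Set Filter Topology Metric Function InnerProductSpace
open scoped RealInnerProductSpace

namespace Summit.NavierStokesRegularity.NavierStokesRegularity.Theorems.PowerGaugeEulerLiouville.NodalContinuum

/-- `|Aζ| ≥ μ|ζ|` when every eigen-coordinate of `ζ` belongs to an eigenvalue of modulus `≥ μ` or vanishes. [folklore] -/
theorem norm_apply_ge_of_eigen {A : EuclideanSpace ℝ (Fin 3) →L[ℝ] EuclideanSpace ℝ (Fin 3)}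
    (hA : (A : EuclideanSpace ℝ (Fin 3) →ₗ[ℝ] EuclideanSpace ℝ (Fin 3)).IsSymmetric)
    (b : OrthonormalBasis (Fin 3) ℝ (EuclideanSpace ℝ (Fin 3))) {a : Fin 3 → ℝ}
    (hb : ∀ i, A (b i) = a i • b i) {μ : ℝ} (hμ : 0 < μ) (hpos : ∀ i, 0 < a i → μ ≤ a i)
    (ζ : EuclideanSpace ℝ (Fin 3)) (hneg : ∀ i, ¬ 0 < a i → a i ≤ -μ ∨ ⟪b i, ζ⟫ = 0) :
    μ * ‖ζ‖ ≤ ‖A ζ‖ := by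
  have hc : ∀ i, ⟪b i, A ζ⟫ = a i * ⟪b i, ζ⟫ := by
    intro i
    have := hA (b i) ζ
    simp only [ContinuousLinearMap.coe_coe] at this
    rw [← this, hb, real_inner_smul_left]
  have hsq : (μ * ‖ζ‖) ^ 2 ≤ ‖A ζ‖ ^ 2 := by
    rw [mul_pow, ← b.sum_sq_inner_right ζ, ← b.sum_sq_inner_right (A ζ), Finset.mul_sum]
    refine Finset.sum_le_sum fun i _ => ?_
    rw [hc i, mul_pow]
    by_cases hi : 0 < a i
    · have h1 : μ ^ 2 ≤ a i ^ 2 := pow_le_pow_left₀ hμ.le (hpos i hi) 2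
      exact mul_le_mul_of_nonneg_right h1 (sq_nonneg _)
    · rcases hneg i hi with h1 | h1
      · have h2 : μ ^ 2 ≤ a i ^ 2 := by nlinarith
        exact mul_le_mul_of_nonneg_right h2 (sq_nonneg _)
      · simp [h1]
  exact (pow_le_pow_iff_left₀ (by positivity) (norm_nonneg _) two_ne_zero).1 hsq

/-- **Tube dynamics with forcing.**  See the module docstring: eigenframe splitting `p + m = |ξ|²` of the transversal
coordinate with the forced differential inequalities, the quadratic-form bound and the kernel-coordinate derivative.
[cite: KatokHasselblatt1995, §6.2 (cone criterion)] [cite: ConstantinIgnatovaVicol2026Putative, §3.4.3–§3.5] -/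
theorem tube_inequalities {A : EuclideanSpace ℝ (Fin 3) →L[ℝ] EuclideanSpace ℝ (Fin 3)}
    (hA : (A : EuclideanSpace ℝ (Fin 3) →ₗ[ℝ] EuclideanSpace ℝ (Fin 3)).IsSymmetric)
    (b : OrthonormalBasis (Fin 3) ℝ (EuclideanSpace ℝ (Fin 3))) {a : Fin 3 → ℝ}
    (hb : ∀ i, A (b i) = a i • b i) {μ α : ℝ} (hμ : 0 < μ) (hαge : ∀ i, a i ≤ α)
    (hpos_i : ∀ i, 0 < a i → μ ≤ a i) {e : EuclideanSpace ℝ (Fin 3)} (he1 : ‖e‖ = 1) (hAe : A e = 0)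
    (hneg_i : ∀ ξ : EuclideanSpace ℝ (Fin 3), ⟪e, ξ⟫ = 0 → ∀ i, ¬ 0 < a i → a i ≤ -μ ∨ ⟪b i, ξ⟫ = 0)
    {V : EuclideanSpace ℝ (Fin 3) → EuclideanSpace ℝ (Fin 3)} {Y : ℝ → EuclideanSpace ℝ (Fin 3)}
    (hY : ∀ t, HasDerivAt Y ((-1 : ℝ) • V (Y t)) t) {z : EuclideanSpace ℝ (Fin 3)}
    {g g' : ℝ → EuclideanSpace ℝ (Fin 3)} (hge : ∀ τ, ⟪e, g τ⟫ = 0) (hgd : ∀ τ, HasDerivAt g (g' τ) τ)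
    {φ : ℝ → ℝ} {σ : ℝ → ℝ} (hσ : ∀ t, σ t = ⟪e, Y t - z⟫) {ξ : ℝ → EuclideanSpace ℝ (Fin 3)}
    (hξ : ∀ t, ξ t = Y t - z - σ t • e - g (σ t)) {ρ Λ t₁ : ℝ} (hρ : 0 ≤ ρ) (hΛ : 0 ≤ Λ) (hΛ1 : Λ ≤ 1)
    (hE : ∀ t ∈ Icc 0 t₁, ‖V (Y t) - φ (σ t) • e - A (ξ t)‖ ≤ ρ * ‖ξ t‖)
    (hg'b : ∀ t ∈ Icc 0 t₁, ‖g' (σ t)‖ ≤ Λ) :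
    ∃ p m pd md : ℝ → ℝ,
      (∀ t, p t + m t = ‖ξ t‖ ^ 2) ∧ (∀ t, 0 ≤ p t) ∧ (∀ t, 0 ≤ m t) ∧
      (∀ t, HasDerivAt p (pd t) t) ∧ (∀ t, HasDerivAt m (md t) t) ∧
      (∀ t ∈ Icc 0 t₁, pd t ≤ -μ * p t + 18 * ρ ^ 2 / μ * (p t + m t) + 2 * Λ ^ 2 / μ * φ (σ t) ^ 2) ∧
      (∀ t ∈ Icc 0 t₁,
        μ * m t - 18 * ρ ^ 2 / μ * (p t + m t) - 2 * Λ ^ 2 / μ * φ (σ t) ^ 2 ≤ md t) ∧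
      (∀ t, ⟪A (ξ t), ξ t⟫ ≤ α * p t - μ * m t) ∧
      (∀ t, HasDerivAt σ (-φ (σ t) - ⟪e, V (Y t) - φ (σ t) • e - A (ξ t)⟫) t) := by
  classical
  have hee : ⟪e, e⟫ = 1 := by rw [real_inner_self_eq_norm_sq, he1]; norm_num
  have hξe : ∀ t, ⟪e, ξ t⟫ = 0 := by
    intro t; rw [hξ t, inner_sub_right, inner_sub_right, inner_smul_right, hee, hge, ← hσ t]; ring
  have hsym : ∀ v, ⟪e, A v⟫ = 0 := by
    intro v
    have := hA e v
    simp only [ContinuousLinearMap.coe_coe] at this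
    rw [← this, hAe, inner_zero_left]
  -- the error term and the kernel-coordinate derivative
  set E : ℝ → EuclideanSpace ℝ (Fin 3) := fun t => V (Y t) - φ (σ t) • e - A (ξ t) with hEdef
  have heE : ∀ t, ⟪e, E t⟫ = ⟪e, V (Y t)⟫ - φ (σ t) := by
    intro t; simp only [hEdef, inner_sub_right, inner_smul_right, hee, hsym]; ring
  have hζ' : ∀ t, HasDerivAt (fun s => Y s - z) ((-1 : ℝ) • V (Y t)) t := fun t => (hY t).sub_const z
  have hσ' : ∀ t, HasDerivAt σ (-φ (σ t) - ⟪e, E t⟫) t := by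
    intro t
    have h1 := (hasDerivAt_const t e).inner ℝ (hζ' t)
    have h2 : HasDerivAt (fun s => ⟪e, Y s - z⟫) (-φ (σ t) - ⟪e, E t⟫) t := by
      refine h1.congr_deriv ?_
      simp only [inner_zero_left, add_zero, inner_smul_right, heE t]
      ring
    exact h2.congr_of_eventuallyEq (Eventually.of_forall hσ)
  -- `ξ' = −Aξ − F`
  set F : ℝ → EuclideanSpace ℝ (Fin 3) :=
    fun t => E t - ⟪e, E t⟫ • e - (φ (σ t) + ⟪e, E t⟫) • g' (σ t) with hFdef
  have hξ' : ∀ t, HasDerivAt ξ (-(A (ξ t)) - F t) t := by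
    intro t
    have hgσ : HasDerivAt (fun s => g (σ s)) ((-φ (σ t) - ⟪e, E t⟫) • g' (σ t)) t :=
      (hgd (σ t)).scomp t (hσ' t)
    have h1 := ((hζ' t).sub ((hσ' t).smul_const e)).sub hgσ
    refine (h1.congr_deriv ?_).congr_of_eventuallyEq (Eventually.of_forall hξ)
    have hV : V (Y t) = E t + φ (σ t) • e + A (ξ t) := by simp only [hEdef]; abel
    rw [hV]
    simp only [hFdef, smul_add, neg_smul, one_smul, sub_smul, add_smul]
    abel
  -- size of `F`
  have hEe : ∀ t ∈ Icc 0 t₁, |⟪e, E t⟫| ≤ ρ * ‖ξ t‖ := fun t ht =>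
    ((abs_real_inner_le_norm _ _).trans (by rw [he1, one_mul])).trans (hE t ht)
  have hFle : ∀ t ∈ Icc 0 t₁, ‖F t‖ ≤ 3 * ρ * ‖ξ t‖ + Λ * |φ (σ t)| := by
    intro t ht
    have h1 := hE t ht
    have h2 : ‖⟪e, E t⟫ • e‖ ≤ ρ * ‖ξ t‖ := by
      rw [norm_smul, Real.norm_eq_abs, he1, mul_one]; exact hEe t ht
    have h3 : ‖(φ (σ t) + ⟪e, E t⟫) • g' (σ t)‖ ≤ Λ * |φ (σ t)| + ρ * ‖ξ t‖ := by
      rw [norm_smul, Real.norm_eq_abs]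
      have hg1 := hg'b t ht
      calc |φ (σ t) + ⟪e, E t⟫| * ‖g' (σ t)‖ ≤ (|φ (σ t)| + |⟪e, E t⟫|) * Λ :=
            mul_le_mul (abs_add_le _ _) hg1 (norm_nonneg _) (by positivity)
        _ = Λ * |φ (σ t)| + |⟪e, E t⟫| * Λ := by ring
        _ ≤ Λ * |φ (σ t)| + ρ * ‖ξ t‖ * 1 :=
            add_le_add le_rfl (mul_le_mul (hEe t ht) hΛ1 hΛ (by positivity))
        _ = Λ * |φ (σ t)| + ρ * ‖ξ t‖ := by ring
    calc ‖F t‖ ≤ ‖E t - ⟪e, E t⟫ • e‖ + ‖(φ (σ t) + ⟪e, E t⟫) • g' (σ t)‖ := norm_sub_le _ _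
      _ ≤ (‖E t‖ + ‖⟪e, E t⟫ • e‖) + ‖(φ (σ t) + ⟪e, E t⟫) • g' (σ t)‖ :=
          add_le_add (norm_sub_le _ _) le_rfl
      _ ≤ 3 * ρ * ‖ξ t‖ + Λ * |φ (σ t)| := by linarith only [h1, h2, h3]
  have hF2 : ∀ t ∈ Icc 0 t₁, ‖F t‖ ^ 2 / μ ≤ 18 * ρ ^ 2 / μ * ‖ξ t‖ ^ 2 + 2 * Λ ^ 2 / μ * φ (σ t) ^ 2 := by
    intro t ht
    have h1 := pow_le_pow_left₀ (norm_nonneg _) (hFle t ht) 2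
    have h2 : (3 * ρ * ‖ξ t‖ + Λ * |φ (σ t)|) ^ 2 ≤ 18 * ρ ^ 2 * ‖ξ t‖ ^ 2 + 2 * Λ ^ 2 * φ (σ t) ^ 2 := by
      have := sq_abs (φ (σ t))
      nlinarith [sq_nonneg (3 * ρ * ‖ξ t‖ - Λ * |φ (σ t)|), this]
    have h3 := div_le_div_of_nonneg_right (h1.trans h2) hμ.le
    calc ‖F t‖ ^ 2 / μ ≤ (18 * ρ ^ 2 * ‖ξ t‖ ^ 2 + 2 * Λ ^ 2 * φ (σ t) ^ 2) / μ := h3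
      _ = 18 * ρ ^ 2 / μ * ‖ξ t‖ ^ 2 + 2 * Λ ^ 2 / μ * φ (σ t) ^ 2 := by field_simp
  -- eigen-coordinates
  set Ip : Finset (Fin 3) := Finset.univ.filter (fun i => 0 < a i) with hIp
  set In : Finset (Fin 3) := Finset.univ.filter (fun i => ¬ 0 < a i) with hIn
  set p : ℝ → ℝ := fun t => ∑ i ∈ Ip, ⟪b i, ξ t⟫ ^ 2 with hpdef
  set m : ℝ → ℝ := fun t => ∑ i ∈ In, ⟪b i, ξ t⟫ ^ 2 with hmdef
  set pd : ℝ → ℝ := fun t => ∑ i ∈ Ip, 2 * ⟪b i, ξ t⟫ * ⟪b i, -(A (ξ t)) - F t⟫ with hpd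
  set md : ℝ → ℝ := fun t => ∑ i ∈ In, 2 * ⟪b i, ξ t⟫ * ⟪b i, -(A (ξ t)) - F t⟫ with hmd
  have hcoord : ∀ i t, HasDerivAt (fun s => ⟪b i, ξ s⟫) ⟪b i, -(A (ξ t)) - F t⟫ t := by
    intro i t
    have := (hasDerivAt_const t (b i)).inner ℝ (hξ' t)
    simpa using this
  have hp' : ∀ t, HasDerivAt p (pd t) t := by
    intro t
    simp only [hpdef, hpd]
    refine HasDerivAt.fun_sum fun i _ => ?_
    have := (hcoord i t).mul (hcoord i t)
    simp only [← sq] at this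
    exact this.congr_deriv (by ring)
  have hm' : ∀ t, HasDerivAt m (md t) t := by
    intro t
    simp only [hmdef, hmd]
    refine HasDerivAt.fun_sum fun i _ => ?_
    have := (hcoord i t).mul (hcoord i t)
    simp only [← sq] at this
    exact this.congr_deriv (by ring)
  have hpm : ∀ t, p t + m t = ‖ξ t‖ ^ 2 := fun t => sum_sq_inner_filter_add b _ (ξ t)
  have hpnn : ∀ t, 0 ≤ p t := fun t => Finset.sum_nonneg fun i _ => sq_nonneg _
  have hmnn : ∀ t, 0 ≤ m t := fun t => Finset.sum_nonneg fun i _ => sq_nonneg _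
  have hIp' : ∀ i ∈ Ip, μ ≤ a i := fun i hi => hpos_i i (Finset.mem_filter.1 hi).2
  have hIn' : ∀ t, ∀ i ∈ In, a i ≤ -μ ∨ ⟪b i, ξ t⟫ = 0 :=
    fun t i hi => hneg_i (ξ t) (hξe t) i (Finset.mem_filter.1 hi).2
  refine ⟨p, m, pd, md, hpm, hpnn, hmnn, hp', hm', ?_, ?_, ?_, ?_⟩
  · intro t ht
    have h1 := sum_coord_velocity_le hA b hb hμ Ip hIp' (ξ t) (F t)
    have h2 := hF2 t ht
    rw [← hpm t] at h2
    show pd t ≤ _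
    simp only [hpd, hpdef]
    linarith only [h1, h2]
  · intro t ht
    have h1 := sum_coord_velocity_ge hA b hb hμ In (ξ t) (F t) (hIn' t)
    have h2 := hF2 t ht
    rw [← hpm t] at h2
    show _ ≤ md t
    simp only [hmd, hmdef]
    linarith only [h1, h2]
  · intro t
    exact inner_apply_self_le_of_eigen' hA b hb hαge (ξ t) (hneg_i (ξ t) (hξe t))
  · intro t
    exact (hσ' t).congr_deriv (by simp only [hEdef])

end Summit.NavierStokesRegularity.NavierStokesRegularity.Theorems.PowerGaugeEulerLiouville.NodalContinuum
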